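import Mathlib.Analysis.SpecialFunctions.Pow.Real
import Mathlib.Analysis.SpecialFunctions.Log.Basic
import Mathlib.Order.Filter.AtTopBot.Basic
import HarnessLib

/-!
# Hardness certificate for crux `BoundaryDefectGaussianR` — Stub H5: reading the exponent `1/3` off
# two-sided geometric bounds (stmt-CriticalPhenomena-14132, line `rainbow-monomials-in-excursion-kernels`)

Pure real analysis: an antitone positive sequence `θ` with `c (n+1)^{-2/3} ≤ θ(4n+3)²` and
`θ(12(n+1))² ≤ C (n+1)^{-2/3}` for all large `n` satisfies `log θ(m) / log m → -1/3`. For the upper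
bound take `n + 1 = ⌊m/12⌋` (so `12(n+1) ≤ m ≤ 24(n+1)` and `θ m ≤ θ(12(n+1))`), for the lower bound
`θ m ≥ θ(4m+3)`; both give `log θ m = -(1/3) log m + O(1)`.
-/

noncomputable section

open Filter Topology

namespace Summit.CriticalPhenomena.CardyFormulaZ2.Cruxes.BoundaryDefectGaussianR.RainbowMonomialsInExcursionKernels

/-- `log (x ^ (-2/3)) = -(2/3) log x` for `x > 0`. [folklore] -/
theorem expo_log_rpow_neg23 {x : ℝ} (hx : 0 < x) :
    Real.log (x ^ (-(2 / 3 : ℝ))) = -(2 / 3 : ℝ) * Real.log x :=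
  Real.log_rpow hx _

/-- From `θ² ≤ C x^{-2/3}` (`θ, C, x > 0`): `2 log θ ≤ log C - (2/3) log x`. [folklore] -/
theorem expo_upper_step {θ C x : ℝ} (hθ : 0 < θ) (hC : 0 < C) (hx : 0 < x)
    (h : θ ^ 2 ≤ C * x ^ (-(2 / 3 : ℝ))) :
    2 * Real.log θ ≤ Real.log C - (2 / 3 : ℝ) * Real.log x := by
  have h1 : Real.log (θ ^ 2) ≤ Real.log (C * x ^ (-(2 / 3 : ℝ))) :=
    Real.log_le_log (by positivity) h
  rw [Real.log_pow, Real.log_mul hC.ne' (Real.rpow_pos_of_pos hx _).ne', expo_log_rpow_neg23 hx] at h1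
  push_cast at h1
  linarith

/-- From `c x^{-2/3} ≤ θ²` (`c, x > 0`): `log c - (2/3) log x ≤ 2 log θ`. [folklore] -/
theorem expo_lower_step {θ c x : ℝ} (hc : 0 < c) (hx : 0 < x)
    (h : c * x ^ (-(2 / 3 : ℝ)) ≤ θ ^ 2) :
    Real.log c - (2 / 3 : ℝ) * Real.log x ≤ 2 * Real.log θ := by
  have h1 : Real.log (c * x ^ (-(2 / 3 : ℝ))) ≤ Real.log (θ ^ 2) :=
    Real.log_le_log (by positivity) h
  rw [Real.log_pow, Real.log_mul hc.ne' (Real.rpow_pos_of_pos hx _).ne', expo_log_rpow_neg23 hx] at h1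
  push_cast at h1
  linarith

/-- **Stub H5.** An antitone positive sequence `θ` with `c (n+1)^{-2/3} ≤ θ(4n+3)²` and
`θ(12(n+1))² ≤ C (n+1)^{-2/3}` eventually satisfies `log θ(n) / log n → -1/3`. [folklore] -/
theorem h19_exponent_of_twoSided : ∀ (θ : ℕ → ℝ), Antitone θ → (∀ n, 0 < θ n) → ∀ (c C : ℝ), 0 < c → 0 < C →
    (∀ᶠ n : ℕ in Filter.atTop, c * ((n : ℝ) + 1) ^ (-(2 / 3 : ℝ)) ≤ θ (4 * n + 3) ^ 2 ∧
      θ (12 * (n + 1)) ^ 2 ≤ C * ((n : ℝ) + 1) ^ (-(2 / 3 : ℝ))) →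
    Filter.Tendsto (fun n : ℕ ↦ Real.log (θ n) / Real.log n) Filter.atTop (nhds (-(1 / 3 : ℝ))) := by
  intro θ hanti hpos c C hc hC hev
  obtain ⟨N₀, hN₀⟩ := Filter.eventually_atTop.1 hev
  -- the two comparison sequences
  set A : ℝ := (1 / 2 : ℝ) * Real.log c - (1 / 3 : ℝ) * Real.log 2 with hA
  set B : ℝ := (1 / 2 : ℝ) * Real.log C + (1 / 3 : ℝ) * Real.log 24 with hB
  have hlog : Tendsto (fun m : ℕ ↦ Real.log (m : ℝ)) atTop atTop :=
    Real.tendsto_log_atTop.comp tendsto_natCast_atTop_atTop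
  have hlimA : Tendsto (fun m : ℕ ↦ -(1 / 3 : ℝ) + A / Real.log (m : ℝ)) atTop (nhds (-(1 / 3 : ℝ))) := by
    simpa using tendsto_const_nhds.add (tendsto_const_nhds.div_atTop hlog)
  have hlimB : Tendsto (fun m : ℕ ↦ -(1 / 3 : ℝ) + B / Real.log (m : ℝ)) atTop (nhds (-(1 / 3 : ℝ))) := by
    simpa using tendsto_const_nhds.add (tendsto_const_nhds.div_atTop hlog)
  refine tendsto_of_tendsto_of_tendsto_of_le_of_le' hlimA hlimB ?_ ?_
  · -- LOWER bound: `θ m ≥ θ (4m+3)` and `θ(4m+3)² ≥ c (m+1)^{-2/3}`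
    filter_upwards [Filter.eventually_ge_atTop (max N₀ 2)] with m hm
    have hmN : N₀ ≤ m := le_trans (le_max_left _ _) hm
    have hm2 : 2 ≤ m := le_trans (le_max_right _ _) hm
    have hmR : (2 : ℝ) ≤ m := by exact_mod_cast hm2
    have hlogm : 0 < Real.log (m : ℝ) := Real.log_pos (by linarith)
    have h1 : θ (4 * m + 3) ≤ θ m := hanti (by omega)
    have h2 := (hN₀ m hmN).1
    have h3 := expo_lower_step hc (by positivity) h2
    have h4 : Real.log (θ (4 * m + 3)) ≤ Real.log (θ m) := Real.log_le_log (hpos _) h1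
    have h5 : Real.log ((m : ℝ) + 1) ≤ Real.log 2 + Real.log (m : ℝ) := by
      rw [← Real.log_mul (by norm_num) (by positivity)]
      exact Real.log_le_log (by positivity) (by linarith)
    -- so `log θ m ≥ A - (1/3) log m`
    have h6 : A - (1 / 3 : ℝ) * Real.log (m : ℝ) ≤ Real.log (θ m) := by
      rw [hA]; nlinarith
    rw [le_div_iff₀ hlogm]
    have : (-(1 / 3 : ℝ) + A / Real.log (m : ℝ)) * Real.log (m : ℝ) = A - (1 / 3 : ℝ) * Real.log (m : ℝ) := by
      field_simp; ring
    rw [this]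
    exact h6
  · -- UPPER bound: `θ m ≤ θ (12(n+1))`, `n + 1 = m / 12`, and `θ(12(n+1))² ≤ C (n+1)^{-2/3}`
    filter_upwards [Filter.eventually_ge_atTop (12 * N₀ + 24)] with m hm
    set n : ℕ := m / 12 - 1 with hn
    have hdiv : 1 ≤ m / 12 := (Nat.le_div_iff_mul_le (by norm_num)).2 (by omega)
    have hn1 : n + 1 = m / 12 := by omega
    have h12 : 12 * (n + 1) ≤ m := by rw [hn1]; exact Nat.mul_div_le m 12
    have hlt : m < 12 * (m / 12 + 1) := by
      have := Nat.lt_mul_div_succ m (by norm_num : 0 < 12)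
      linarith
    have hmN : N₀ ≤ n := by
      have : N₀ + 2 ≤ m / 12 := (Nat.le_div_iff_mul_le (by norm_num)).2 (by omega)
      omega
    have h24 : (m : ℝ) ≤ 24 * ((n : ℝ) + 1) := by
      have : m ≤ 24 * (n + 1) := by omega
      exact_mod_cast this
    have hm2 : (2 : ℝ) ≤ m := by
      have : 2 ≤ m := by omega
      exact_mod_cast this
    have hlogm : 0 < Real.log (m : ℝ) := Real.log_pos (by linarith)
    have h1 : θ m ≤ θ (12 * (n + 1)) := hanti h12
    have h2 := (hN₀ n hmN).2
    have h3 := expo_upper_step (hpos _) hC (by positivity) h2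
    have h4 : Real.log (θ m) ≤ Real.log (θ (12 * (n + 1))) := Real.log_le_log (hpos _) h1
    have h5 : Real.log (m : ℝ) ≤ Real.log 24 + Real.log ((n : ℝ) + 1) := by
      rw [← Real.log_mul (by norm_num) (by positivity)]
      exact Real.log_le_log (by positivity) h24
    -- so `log θ m ≤ B - (1/3) log m`
    have h6 : Real.log (θ m) ≤ B - (1 / 3 : ℝ) * Real.log (m : ℝ) := by
      rw [hB]; nlinarith
    rw [div_le_iff₀ hlogm]
    have : (-(1 / 3 : ℝ) + B / Real.log (m : ℝ)) * Real.log (m : ℝ) = B - (1 / 3 : ℝ) * Real.log (m : ℝ) := by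
      field_simp; ring
    rw [this]
    exact h6

end Summit.CriticalPhenomena.CardyFormulaZ2.Cruxes.BoundaryDefectGaussianR.RainbowMonomialsInExcursionKernels

end
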